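import Summits.ABC.IUTFork.Cor312LicenceShallowMultiSlotLicence
import Summits.ABC.IUTFork.Cor312LicenceShallowRealising
import HarnessLib

/-!
# [IUTchIII] Cor. 3.12 — the tame MULTI-SLOT licence for REALISING ideles over a NON-UNIFORMLY ramified fibre:
# donation rate `ρ_p = p^{1 − 1/m_p}` from a LOWER BOUND `m_p ≤ e(x|p)` on the ramification over `p`

PROOF-ONLY record file (no `def`, no new `Prop`, no instance) of the abc-iut cell (WAVE-5 prover seat abc-iut-w5-d009, gen 9; row
«GENUINE-WINDOW-SMALL-L» §3 = abc-iut-w5-d180's open item «multi-slot version with NON-uniform fibres (different `e_x` over one `p`: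
use `…_of_tame_slots` with `ρ_p` = min donation)», HOME/HANDOFF.md 11:4xZ). TAKES NO SIDE on [IUTchIII] Cor. 3.12 or on any author.

abc-iut-w5-d180's `licence_settingPrVolSharp_of_tame_slots` (p440550 ✓) proves the (xi-f) licence at the sharp real settings from a
donation rate `ρ_p ≥ 1` with `ρ_p ≤ ‖p‖⁻¹·‖ϖ_x‖ = p^{1−1/e_x}` at EVERY place `x | p` and per-(bad place, label) level windows; its
orders form `qRegion_subset_thetaHull_settingDHVolSharp_of_tame_orders` (p441217 ✓) assumes a UNIFORMLY ramified fibre (every `x | p`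
with the same `e`). Over the torsion fields `K = F(E_F[l])` of initial Θ-data the fibres are NOT uniformly ramified in general (`K/ℚ`
need not be Galois), so this file instantiates the rate with a LOWER BOUND `m_p ≤ e(x|p)` (`x | p`): `ρ_p := p^{1−1/m_p}` — the
minimum donation — and reads the level windows for ideles REALISING the pilot divisors (Dupuy–Hilado (3.4): `‖t_{q,w}‖ = p^{−P_q(w)/e_w}`,
`‖t_{Θ,j,w}‖ = p^{−j²P_q(w)/e_w}`, abc-iut-w5-d236 `norm_qIdele_eq_rpow_of_realises` / `norm_thetaIdele_eq_rpow_of_realises`).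

WHAT IS PROVED (namespace `Summit.ABC.IUTFork.Thm311.Real`; elementary exponent bookkeeping in base `p`):
* `slot_window_of_realises_level` — at a bad `w | p` (`e = e_w`, `P = P_q(w)`) and label `j = i+1`, a LEVEL `k ∈ ℤ` with
  `e·k + 1 ≤ j²·P ≤ e·(k+1)` and `m·(e·k + 1) ≤ m·P + j·e·(m − 1)` yields abc-iut-w5-d180's window disjunct for the rate `p^{1−1/m}`
  (`‖p‖·‖p‖^k‖ϖ_w‖ < ‖t_Θ‖ ≤ ‖p‖^k‖ϖ_w‖`, `‖t_q‖ ≤ ρ^j·‖p‖^k‖ϖ_w‖`, `ϖ_w` the uniformizer of norm `p^{−1/e}`);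
* `rate_le_of_minRam` — `p^{1−1/m} ≤ ‖p‖⁻¹·‖ϖ_x‖` at every `x | p` with `m ≤ e(x|p)`; `one_le_rate` — `1 ≤ p^{1−1/m}`;
* **`licence_settingPrVolSharp_of_realises_minRam`** / `…settingDHVolSharp…` — the (xi-f) licence at abc-iut-c312-7's / c312-3's sharp
  settings for realising ideles, from: tameness and `m_p ≤ e(x|p)` at every place over a bad prime, and the integer windows above at
  every bad `(w, j)`; **`exists_qPinned_and_hull_settingPrVolSharp_of_realises_minRam`** — branch C's antecedent there (any columns).
* **`licence_settingPrVolSharp_of_realises_minRam_int`** — for INTEGRAL pilot degrees `P_q(w) = P ∈ ℤ_{≥1}` (e.g. `2l ∣ ord_w(q)`) ONE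
  inequality per bad place suffices: **`m_p·(l⋆² − 1)·P ≤ l⋆·e_w·(m_p − 1)`** (top label; the other labels follow by `sq_sub_one_mul_le`,
  the level is `k = ⌊(j²P − 1)/e_w⌋`).

READING (neutral): with `m_p = e` at a uniformly ramified fibre this is abc-iut-w5-d180's orders window `m_q ≥ e⌈m_Θ/e⌉ − (j+1)(e−1)`;
with `m_p = 1` (some place over `p` unramified) there is no donation and the window is abc-iut-w5-d236's one-factor one. The GENUINE
`K`-level corollary (initial Θ-data, `pilotDataOfK`) is the sequel file. HONEST SCOPE as in the companions: OUR sharp containers and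
Dupuy–Hilado's typed (Ind2) acting per capsule slot and place; the licence is a STRONGER-THAN-PRINT form; nothing about the printed GLOBAL
inequality; nothing asserts or refutes [IUTchIII] Cor. 3.12; typed ≠ proved; instantiated ≠ endorsed.
[cite: Mochizuki2012, IUTchIII Cor. 3.12 p. 173–175, Step (xi) (xi-f) p. 184, Thm. 3.11 (i) (Ind2) p. 154] [cite: DupuyHilado2025, §3.4, §3.9, §4.9]
[cite: NeukirchANT1999, Ch. II Prop. (5.5), (6.8)] [claim: Mochizuki2012, status: disputed] for every IUT sentence quoted.
-/

noncomputable section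

open Set Function NumberField IsDedekindDomain
open scoped Pointwise

namespace Summit.ABC.IUTFork.Thm311.Real

open Cor312 Cor312.Setting Cor312Vol Literature.IUT.LogThetaLattice Literature.IUT.LogVolume
open Literature.NumberTheory.NumberFields Literature.NumberTheory.GaloisRepresentations.Ultrametric

variable {F : Type} [Field F] [NumberField F] (X : PilotData F) {logv : PadicLogs F} (hlog : LogvAnalytic logv)
  (M : Type) [Field M] [NumberField M]
  (archPk : ∀ (j : (thetaIndex X).Label) (vQ : (thetaIndex X).VQ), Set ((logShellsDH X logv).Packet j vQ))
  (archSub : ∀ (j : (thetaIndex X).Label) (v : (thetaIndex X).V),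
    Set ((logShellsDH X logv).Packet j ((thetaIndex X).over v)))
  (Ψ : ℤ → ∀ v : (thetaIndex X).V, v ∈ (thetaIndex X).Vbad → Set ((logShellsDH X logv).StarPacket v))
  (act : ℤ → ∀ v : (thetaIndex X).V, v ∈ (thetaIndex X).Vbad →
    (logShellsDH X logv).StarPacket v → Module.End ℚ ((logShellsDH X logv).StarPacket v))
  (Mmod : ℤ → ∀ j : (thetaIndex X).LabelStar, Set ((logShellsDH X logv).GlobalPacket j.1))
  (region : ℤ → ∀ j : (thetaIndex X).LabelStar, FinDivisor M → ∀ vQ : (thetaIndex X).VQ,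
    Set ((logShellsDH X logv).Packet j.1 vQ))
  (n : ℤ) {HT : Type} {LogLink : HT → HT → Type} {IsFull : ∀ {s t : HT}, LogLink s t → Prop}
  (lat : LGPGaussianLogThetaLattice LogLink IsFull)
  {Frd : Type} {IsoF : Frd → Frd → Type} {Ob : Frd → Type} {realify : Frd → Frd} {Strip : Type}
  {IsoS : Strip → Strip → Type} {Mv : ∀ v : (thetaIndex X).V, v ∈ (thetaIndex X).Vbad → Type}
  [∀ v h, Monoid (Mv v h)]
  (sig : GlobalLGPFrobenioidSignature (thetaIndex X).lstar (thetaIndex X).V (· ∈ (thetaIndex X).Vbad)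
    Frd IsoF Ob realify Strip IsoS Mv)
  (split : SplittingMonoids Mv) {ObΔ : Type} {N : ∀ v : (thetaIndex X).V, v ∈ (thetaIndex X).Vbad → Type}
  [∀ v h, Monoid (N v h)] (qData : QPilotData ObΔ N)
  (tq : ∀ (pp : Nat.Primes) (x : (thetaIndex X).Fibre (.inr pp)), haveI : Fact (pp : ℕ).Prime := ⟨pp.2⟩; kOf X pp.1 x)
  (t : ∀ (pp : Nat.Primes) (_ : Fin X.lstar) (x : (thetaIndex X).Fibre (.inr pp)),
    haveI : Fact (pp : ℕ).Prime := ⟨pp.2⟩; kOf X pp.1 x)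
  (htq0 : ∀ pp x, tq pp x ≠ 0)
  (htq1 : ∀ (pp : Nat.Primes) (x : (thetaIndex X).Fibre (.inr pp)),
    haveI : Fact (pp : ℕ).Prime := ⟨pp.2⟩; placeOf X pp.1 x ∉ X.S → ‖tq pp x‖ = 1)
  (col : ℤ → Column (logShellsDH X logv))
  (ht0 : ∀ pp i x, t pp i x ≠ 0)
  (ht : ∀ (pp : Nat.Primes) (i : Fin X.lstar) (x : (thetaIndex X).Fibre (.inr pp)),
    haveI : Fact (pp : ℕ).Prime := ⟨pp.2⟩
    Real.log ‖t pp i x‖ = -(X.thetaPilot i (placeOf X pp.1 x)) * logNorm F (placeOf X pp.1 x) /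
      localDegree F (placeOf X pp.1 x))
  (htq : ∀ (pp : Nat.Primes) (x : (thetaIndex X).Fibre (.inr pp)),
    haveI : Fact (pp : ℕ).Prime := ⟨pp.2⟩
    Real.log ‖tq pp x‖ = -(X.qPilot (placeOf X pp.1 x)) * logNorm F (placeOf X pp.1 x) /
      localDegree F (placeOf X pp.1 x))

/-! ## §1. The rate `p^{1 − 1/m}` -/

/-- `1 ≤ p · p^{−1/m}` for `m ≥ 1` (`p^{−1} ≤ p^{−1/m}`). [folklore] -/
theorem one_le_rate (pp : Nat.Primes) {m : ℕ} (hm : 1 ≤ m) :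
    (1 : ℝ) ≤ ((pp : ℕ) : ℝ) * ((pp : ℕ) : ℝ) ^ (-(1 / (m : ℝ))) := by
  have hp1 : (1 : ℝ) ≤ ((pp : ℕ) : ℝ) := by exact_mod_cast pp.2.one_lt.le
  have hp0 : (0 : ℝ) < ((pp : ℕ) : ℝ) := by positivity
  have hm0 : (0 : ℝ) < (m : ℝ) := by exact_mod_cast hm
  have h : ((pp : ℕ) : ℝ) ^ (-(1 : ℝ)) ≤ ((pp : ℕ) : ℝ) ^ (-(1 / (m : ℝ))) := by
    refine Real.rpow_le_rpow_of_exponent_le hp1 (neg_le_neg ?_)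
    rw [div_le_one hm0]
    exact_mod_cast hm
  calc (1 : ℝ) = ((pp : ℕ) : ℝ) * ((pp : ℕ) : ℝ) ^ (-(1 : ℝ)) := by
        rw [Real.rpow_neg_one, mul_inv_cancel₀ hp0.ne']
    _ ≤ ((pp : ℕ) : ℝ) * ((pp : ℕ) : ℝ) ^ (-(1 / (m : ℝ))) := mul_le_mul_of_nonneg_left h hp0.le

/-- **The minimum donation rate is admissible at every place with `m ≤ e(x|p)`**: `p·p^{−1/m} ≤ ‖p‖⁻¹·‖ϖ_x‖` for the uniformizer
`ϖ_x` of `K_x` of norm `p^{−1/e(x|p)}` (abc-iut-S7's `exists_isUniformizer_rescaledCompletion`). [cite: NeukirchANT1999, Ch. II Prop. (5.5), (6.8)] -/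
theorem rate_le_of_minRam (pp : Nat.Primes) (x : (thetaIndex X).Fibre (.inr pp)) {m : ℕ} (hm : 1 ≤ m)
    (hmx : haveI : Fact (pp : ℕ).Prime := ⟨pp.2⟩; m ≤ (placeOf X pp.1 x).asIdeal.ramificationIdx ℤ) :
    haveI : Fact (pp : ℕ).Prime := ⟨pp.2⟩
    ∃ ϖ : (kOf X pp.1 x)ˣ, IsUniformizer ϖ ∧
      ((pp : ℕ) : ℝ) * ((pp : ℕ) : ℝ) ^ (-(1 / (m : ℝ))) ≤ ‖(pp : ℚ_[pp])‖⁻¹ * ‖(ϖ : kOf X pp.1 x)‖ := by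
  haveI : Fact (pp : ℕ).Prime := ⟨pp.2⟩
  obtain ⟨ϖ, hϖ, hϖn⟩ := exists_isUniformizer_rescaledCompletion F pp.1 (placeOf X pp.1 x) (natCast_mem_placeOf X pp.1 x)
  refine ⟨ϖ, hϖ, ?_⟩
  have hp1 : (1 : ℝ) ≤ ((pp : ℕ) : ℝ) := by exact_mod_cast pp.2.one_lt.le
  have hp0 : (0 : ℝ) < ((pp : ℕ) : ℝ) := by positivity
  have hm0 : (0 : ℝ) < (m : ℝ) := by exact_mod_cast hm
  have he0 : (0 : ℝ) < ((placeOf X pp.1 x).asIdeal.ramificationIdx ℤ : ℝ) := lt_of_lt_of_le hm0 (by exact_mod_cast hmx)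
  rw [hϖn, Padic.norm_p, inv_inv]
  refine mul_le_mul_of_nonneg_left (Real.rpow_le_rpow_of_exponent_le hp1 (neg_le_neg ?_)) hp0.le
  exact one_div_le_one_div_of_le hm0 (by exact_mod_cast hmx)

/-! ## §2. The level window at a bad place for realising ideles -/

include htq0 ht0 ht htq in
/-- **The level window for realising ideles from an INTEGER/REAL level condition.** At a bad `w | p` with `e = e_w`, `P = P_q(w)`, label
`j = i+1`, rate `ρ = p·p^{−1/m}`, `m ≥ 1`: a level `k ∈ ℤ` with `e·k + 1 ≤ j²·P ≤ e·(k+1)` and `m·(e·k + 1) ≤ m·P + j·e·(m − 1)` gives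
abc-iut-w5-d180's disjunct `∃ ϖ k, ‖p‖·(‖p‖^k‖ϖ‖) < ‖t_{Θ,j,w}‖ ≤ ‖p‖^k‖ϖ‖ ∧ ‖t_{q,w}‖ ≤ ρ^j·(‖p‖^k‖ϖ‖)` (exponents of `p`:
`−1−k−1/e < −j²P/e ≤ −k−1/e`, `−P/e ≤ j(1−1/m) − k − 1/e`). [cite: DupuyHilado2025, §3.4, §4.9] [cite: NeukirchANT1999, Ch. II Prop. (5.5)]
[claim: Mochizuki2012, status: disputed] -/
theorem slot_window_of_realises_level (pp : Nat.Primes) (i : Fin X.lstar) (w : (thetaIndex X).Fibre (.inr pp))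
    {m : ℕ} (hm : 1 ≤ m) (k : ℤ)
    (hk1 : haveI : Fact (pp : ℕ).Prime := ⟨pp.2⟩
      (ramIdx F (placeOf X pp.1 w) : ℝ) * k + 1 ≤ (((i : ℕ) + 1 : ℕ) : ℝ) ^ 2 * X.qPilot (placeOf X pp.1 w))
    (hk2 : haveI : Fact (pp : ℕ).Prime := ⟨pp.2⟩
      (((i : ℕ) + 1 : ℕ) : ℝ) ^ 2 * X.qPilot (placeOf X pp.1 w) ≤ (ramIdx F (placeOf X pp.1 w) : ℝ) * (k + 1))
    (hk3 : haveI : Fact (pp : ℕ).Prime := ⟨pp.2⟩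
      (m : ℝ) * ((ramIdx F (placeOf X pp.1 w) : ℝ) * k + 1) ≤
        (m : ℝ) * X.qPilot (placeOf X pp.1 w) + (((i : ℕ) + 1 : ℕ) : ℝ) * (ramIdx F (placeOf X pp.1 w) : ℝ) * ((m : ℝ) - 1)) :
    haveI : Fact (pp : ℕ).Prime := ⟨pp.2⟩
    ∃ (ϖ : (kOf X pp.1 w)ˣ) (k : ℤ), IsUniformizer ϖ ∧
      ‖(pp : ℚ_[pp])‖ * (‖(pp : ℚ_[pp])‖ ^ k * ‖(ϖ : kOf X pp.1 w)‖) < ‖t pp i w‖ ∧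
      ‖t pp i w‖ ≤ ‖(pp : ℚ_[pp])‖ ^ k * ‖(ϖ : kOf X pp.1 w)‖ ∧
      ‖tq pp w‖ ≤ (((pp : ℕ) : ℝ) * ((pp : ℕ) : ℝ) ^ (-(1 / (m : ℝ)))) ^ ((i : ℕ) + 1) *
        (‖(pp : ℚ_[pp])‖ ^ k * ‖(ϖ : kOf X pp.1 w)‖) := by
  haveI : Fact (pp : ℕ).Prime := ⟨pp.2⟩
  set v := placeOf X pp.1 w with hv
  set e : ℕ := ramIdx F v with he
  set P : ℝ := X.qPilot v with hP
  set c : ℝ := (((i : ℕ) + 1 : ℕ) : ℝ) ^ 2 with hc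
  have hp1 : (1 : ℝ) < ((pp : ℕ) : ℝ) := by exact_mod_cast pp.2.one_lt
  have hp0 : (0 : ℝ) < ((pp : ℕ) : ℝ) := by positivity
  have he0 : (0 : ℝ) < (e : ℝ) := by exact_mod_cast Nat.pos_of_ne_zero (ramIdx_ne_zero F v)
  have hm0 : (0 : ℝ) < (m : ℝ) := by exact_mod_cast hm
  -- the uniformizer of norm `p^{−1/e}`
  obtain ⟨ϖ, hϖ, hϖn⟩ := exists_isUniformizer_rescaledCompletion F pp.1 v (natCast_mem_placeOf X pp.1 w)
  rw [← ramIdx_eq F v] at hϖn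
  -- the norms as powers of `p`
  have hnq : ‖tq pp w‖ = ((pp : ℕ) : ℝ) ^ (-P / (e : ℝ)) := norm_qIdele_eq_rpow_of_realises X tq htq0 htq pp w
  have hnt : ‖t pp i w‖ = ((pp : ℕ) : ℝ) ^ (-(c * P) / (e : ℝ)) :=
    norm_thetaIdele_eq_rpow_of_realises X tq t htq0 ht0 ht htq pp i w
  have hnp : ‖((pp : ℕ) : ℚ_[pp])‖ = ((pp : ℕ) : ℝ) ^ (-(1 : ℝ)) := by rw [Padic.norm_p, Real.rpow_neg_one]
  have hnpk : ‖((pp : ℕ) : ℚ_[pp])‖ ^ k = ((pp : ℕ) : ℝ) ^ (-(k : ℝ)) := by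
    rw [hnp, ← Real.rpow_intCast, ← Real.rpow_mul hp0.le]
    ring_nf
  -- `‖p‖^k · ‖ϖ‖ = p^{−k − 1/e}`
  have hL : ‖((pp : ℕ) : ℚ_[pp])‖ ^ k * ‖(ϖ : kOf X pp.1 w)‖ = ((pp : ℕ) : ℝ) ^ (-(k : ℝ) + -(1 / (e : ℝ))) := by
    rw [hnpk, hϖn, Real.rpow_add hp0]
  refine ⟨ϖ, k, hϖ, ?_, ?_, ?_⟩
  · -- `‖p‖·(‖p‖^k‖ϖ‖) < ‖t_Θ‖`: `−1 − k − 1/e < −cP/e`, i.e. `cP < e(k+1) + 1`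
    rw [hL, hnp, ← Real.rpow_add hp0, hnt, Real.rpow_lt_rpow_left_iff hp1]
    have h1 : c * P / (e : ℝ) ≤ (k : ℝ) + 1 := by
      rw [div_le_iff₀ he0]
      linarith
    have h2 : -(c * P) / (e : ℝ) = -(c * P / (e : ℝ)) := by ring
    rw [h2]
    have h3 : (0 : ℝ) < 1 / (e : ℝ) := by positivity
    linarith
  · -- `‖t_Θ‖ ≤ ‖p‖^k‖ϖ‖`: `−cP/e ≤ −k − 1/e`, i.e. `ek + 1 ≤ cP`
    rw [hL, hnt, Real.rpow_le_rpow_left_iff hp1]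
    have h1 : (k : ℝ) + 1 / (e : ℝ) ≤ c * P / (e : ℝ) := by
      rw [le_div_iff₀ he0, add_mul, div_mul_cancel₀ _ he0.ne']
      linarith
    have h2 : -(c * P) / (e : ℝ) = -(c * P / (e : ℝ)) := by ring
    rw [h2]
    linarith
  · -- `‖t_q‖ ≤ ρ^j · (‖p‖^k‖ϖ‖)`: `−P/e ≤ j(1 − 1/m) − k − 1/e`, i.e. `m(ek+1) ≤ mP + je(m−1)`
    have hρ : (((pp : ℕ) : ℝ) * ((pp : ℕ) : ℝ) ^ (-(1 / (m : ℝ)))) ^ ((i : ℕ) + 1) =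
        ((pp : ℕ) : ℝ) ^ ((((i : ℕ) + 1 : ℕ) : ℝ) * (1 - 1 / (m : ℝ))) := by
      have h1 : ((pp : ℕ) : ℝ) * ((pp : ℕ) : ℝ) ^ (-(1 / (m : ℝ))) = ((pp : ℕ) : ℝ) ^ (1 - 1 / (m : ℝ)) := by
        rw [sub_eq_add_neg, Real.rpow_add hp0, Real.rpow_one]
      rw [h1, ← Real.rpow_natCast, ← Real.rpow_mul hp0.le, mul_comm]
    rw [hρ, hL, ← Real.rpow_add hp0, hnq, Real.rpow_le_rpow_left_iff hp1]
    -- goal: `-P/e ≤ j(1 − 1/m) + (−k + −1/e)`; multiply by `e·m > 0`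
    have hem : (0 : ℝ) < (e : ℝ) * (m : ℝ) := mul_pos he0 hm0
    have key : -P / (e : ℝ) * ((e : ℝ) * (m : ℝ)) ≤
        ((((i : ℕ) + 1 : ℕ) : ℝ) * (1 - 1 / (m : ℝ)) + (-(k : ℝ) + -(1 / (e : ℝ)))) * ((e : ℝ) * (m : ℝ)) := by
      have lhs : -P / (e : ℝ) * ((e : ℝ) * (m : ℝ)) = -P * (m : ℝ) := by
        field_simp
      have rhs : ((((i : ℕ) + 1 : ℕ) : ℝ) * (1 - 1 / (m : ℝ)) + (-(k : ℝ) + -(1 / (e : ℝ)))) * ((e : ℝ) * (m : ℝ)) =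
          (((i : ℕ) + 1 : ℕ) : ℝ) * (e : ℝ) * ((m : ℝ) - 1) - (m : ℝ) * ((e : ℝ) * k + 1) := by
        field_simp
        ring
      rw [lhs, rhs]
      linarith
    exact le_of_mul_le_mul_right key hem

/-! ## §3. The licence and branch C's antecedent for realising ideles from a minimum-ramification rate -/

include ht0 ht htq in
/-- **THE (xi-f) LICENCE AT `settingPrVolSharp` FOR REALISING IDELES OVER NON-UNIFORMLY RAMIFIED TAME FIBRES.** Θ- and q-ideles realising
`P_Θ = (j²·P_q)_j`, `P_q`; for every prime `p` under `S` a bound `m_p ≥ 1` with EVERY place `x | p` tame (`p > 2`, `e(x|p) ≤ p − 2`) and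
`m_p ≤ e(x|p)`; at every bad `w | p` (`e = e_w`, `P = P_q(w)`) and label `j = i+1` a level `k ∈ ℤ` with `e·k + 1 ≤ j²P ≤ e·(k+1)` and
`m_p·(e·k + 1) ≤ m_p·P + j·e·(m_p − 1)` ⟹ abc-iut-c312-1's `Thm311ToCor312.Licence` (abc-iut-w5-d180's `licence_settingPrVolSharp_of_tame_slots`
at the rate `ρ_p = p^{1−1/m_p}`). [cite: DupuyHilado2025, §3.4, §3.9, §4.9] [cite: WeilBNT1967, Ch. II §2, Th. 1]
[claim: Mochizuki2012, status: disputed] -/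
theorem licence_settingPrVolSharp_of_realises_minRam (m : Nat.Primes → ℕ) (hm1 : ∀ pp, 1 ≤ m pp)
    (htame : ∀ (pp : Nat.Primes) (x : (thetaIndex X).Fibre (.inr pp)),
      haveI : Fact (pp : ℕ).Prime := ⟨pp.2⟩
      (∃ w : (thetaIndex X).Fibre (.inr pp), placeOf X pp.1 w ∈ X.S) →
        2 < (pp : ℕ) ∧ m pp ≤ (placeOf X pp.1 x).asIdeal.ramificationIdx ℤ ∧
          (placeOf X pp.1 x).asIdeal.ramificationIdx ℤ ≤ (pp : ℕ) - 2)
    (hlev : ∀ (pp : Nat.Primes) (i : Fin X.lstar) (w : (thetaIndex X).Fibre (.inr pp)),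
      haveI : Fact (pp : ℕ).Prime := ⟨pp.2⟩
      placeOf X pp.1 w ∈ X.S →
        ∃ k : ℤ, (ramIdx F (placeOf X pp.1 w) : ℝ) * k + 1 ≤ (((i : ℕ) + 1 : ℕ) : ℝ) ^ 2 * X.qPilot (placeOf X pp.1 w) ∧
          (((i : ℕ) + 1 : ℕ) : ℝ) ^ 2 * X.qPilot (placeOf X pp.1 w) ≤ (ramIdx F (placeOf X pp.1 w) : ℝ) * (k + 1) ∧
          (m pp : ℝ) * ((ramIdx F (placeOf X pp.1 w) : ℝ) * k + 1) ≤
            (m pp : ℝ) * X.qPilot (placeOf X pp.1 w) +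
              (((i : ℕ) + 1 : ℕ) : ℝ) * (ramIdx F (placeOf X pp.1 w) : ℝ) * ((m pp : ℝ) - 1)) :
    Thm311ToCor312.Licence (settingPrVolSharp X hlog M archPk archSub Ψ act Mmod region n lat sig split qData tq t htq0 htq1) := by
  refine licence_settingPrVolSharp_of_tame_slots X hlog M archPk archSub Ψ act Mmod region n lat sig split qData tq t htq0 htq1
    (fun pp => ((pp : ℕ) : ℝ) * ((pp : ℕ) : ℝ) ^ (-(1 / (m pp : ℝ)))) (fun pp => one_le_rate pp (hm1 pp))
    (fun pp i x hx => norm_eq_one_of_realises X t ht0 ht pp i x hx) (fun pp x hS => ?_) (fun pp i w hw => ?_)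
  · obtain ⟨hp2, hmx, hex⟩ := htame pp x hS
    obtain ⟨ϖ, hϖ, hle⟩ := rate_le_of_minRam X pp x (hm1 pp) hmx
    exact ⟨hp2, hex, ϖ, hϖ, hle⟩
  · obtain ⟨k, hk1, hk2, hk3⟩ := hlev pp i w hw
    exact Or.inr (slot_window_of_realises_level X tq t htq0 ht0 ht htq pp i w (hm1 pp) k hk1 hk2 hk3)

include ht0 ht htq in
/-- **The same at the Dupuy–Hilado sharp setting `settingDHVolSharp`** (`licence_settingPrVolSharp_iff_settingDHVolSharp`).
[claim: Mochizuki2012, status: disputed] -/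
theorem licence_settingDHVolSharp_of_realises_minRam (m : Nat.Primes → ℕ) (hm1 : ∀ pp, 1 ≤ m pp)
    (htame : ∀ (pp : Nat.Primes) (x : (thetaIndex X).Fibre (.inr pp)),
      haveI : Fact (pp : ℕ).Prime := ⟨pp.2⟩
      (∃ w : (thetaIndex X).Fibre (.inr pp), placeOf X pp.1 w ∈ X.S) →
        2 < (pp : ℕ) ∧ m pp ≤ (placeOf X pp.1 x).asIdeal.ramificationIdx ℤ ∧
          (placeOf X pp.1 x).asIdeal.ramificationIdx ℤ ≤ (pp : ℕ) - 2)
    (hlev : ∀ (pp : Nat.Primes) (i : Fin X.lstar) (w : (thetaIndex X).Fibre (.inr pp)),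
      haveI : Fact (pp : ℕ).Prime := ⟨pp.2⟩
      placeOf X pp.1 w ∈ X.S →
        ∃ k : ℤ, (ramIdx F (placeOf X pp.1 w) : ℝ) * k + 1 ≤ (((i : ℕ) + 1 : ℕ) : ℝ) ^ 2 * X.qPilot (placeOf X pp.1 w) ∧
          (((i : ℕ) + 1 : ℕ) : ℝ) ^ 2 * X.qPilot (placeOf X pp.1 w) ≤ (ramIdx F (placeOf X pp.1 w) : ℝ) * (k + 1) ∧
          (m pp : ℝ) * ((ramIdx F (placeOf X pp.1 w) : ℝ) * k + 1) ≤
            (m pp : ℝ) * X.qPilot (placeOf X pp.1 w) +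
              (((i : ℕ) + 1 : ℕ) : ℝ) * (ramIdx F (placeOf X pp.1 w) : ℝ) * ((m pp : ℝ) - 1)) :
    Thm311ToCor312.Licence (settingDHVolSharp X hlog M archPk archSub Ψ act Mmod region n lat sig split qData tq t htq0 htq1) := by
  rw [← licence_settingPrVolSharp_iff_settingDHVolSharp]
  exact licence_settingPrVolSharp_of_realises_minRam X hlog M archPk archSub Ψ act Mmod region n lat sig split qData tq t htq0 htq1
    ht0 ht htq m hm1 htame hlev

include ht0 ht htq in
/-- **BRANCH C's ANTECEDENT «∃ ρ qK, QPinned ∧ PilotKummerCompatHull» IS INHABITED at `settingPrVolSharp`** under the same hypotheses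
(any columns `col`; realising q-ideles are integral, `norm_qIdele_le_one_of_realises`), via abc-iut-w5-d180's
`exists_qPinned_and_hull_settingPrVolSharp_of_tame_slots`. [cite: DupuyHilado2025, §3.4, §3.9, §4.9] [claim: Mochizuki2012, status: disputed] -/
theorem exists_qPinned_and_hull_settingPrVolSharp_of_realises_minRam (m : Nat.Primes → ℕ) (hm1 : ∀ pp, 1 ≤ m pp)
    (htame : ∀ (pp : Nat.Primes) (x : (thetaIndex X).Fibre (.inr pp)),
      haveI : Fact (pp : ℕ).Prime := ⟨pp.2⟩
      (∃ w : (thetaIndex X).Fibre (.inr pp), placeOf X pp.1 w ∈ X.S) →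
        2 < (pp : ℕ) ∧ m pp ≤ (placeOf X pp.1 x).asIdeal.ramificationIdx ℤ ∧
          (placeOf X pp.1 x).asIdeal.ramificationIdx ℤ ≤ (pp : ℕ) - 2)
    (hlev : ∀ (pp : Nat.Primes) (i : Fin X.lstar) (w : (thetaIndex X).Fibre (.inr pp)),
      haveI : Fact (pp : ℕ).Prime := ⟨pp.2⟩
      placeOf X pp.1 w ∈ X.S →
        ∃ k : ℤ, (ramIdx F (placeOf X pp.1 w) : ℝ) * k + 1 ≤ (((i : ℕ) + 1 : ℕ) : ℝ) ^ 2 * X.qPilot (placeOf X pp.1 w) ∧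
          (((i : ℕ) + 1 : ℕ) : ℝ) ^ 2 * X.qPilot (placeOf X pp.1 w) ≤ (ramIdx F (placeOf X pp.1 w) : ℝ) * (k + 1) ∧
          (m pp : ℝ) * ((ramIdx F (placeOf X pp.1 w) : ℝ) * k + 1) ≤
            (m pp : ℝ) * X.qPilot (placeOf X pp.1 w) +
              (((i : ℕ) + 1 : ℕ) : ℝ) * (ramIdx F (placeOf X pp.1 w) : ℝ) * ((m pp : ℝ) - 1)) :
    ∃ (ρ' : (∀ v : (thetaIndex X).V, v ∈ (thetaIndex X).Vbad → Set ((logShellsDH X logv).StarPacket v)) →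
          ∀ (j : (thetaIndex X).Label) (vQ : (thetaIndex X).VQ), Set ((logShellsDH X logv).Packet j vQ))
        (qK : ∀ v : (thetaIndex X).V, v ∈ (thetaIndex X).Vbad → Set ((logShellsDH X logv).StarPacket v)),
        QPinned ({ toSituation := situationPrVol X hlog M archPk archSub Ψ act Mmod region, col := col } :
            LatticeSituation (thetaIndex X))
          (settingPrVolSharp X hlog M archPk archSub Ψ act Mmod region n lat sig split qData tq t htq0 htq1) ρ' qK ∧
        PilotKummerCompatHull ({ toSituation := situationPrVol X hlog M archPk archSub Ψ act Mmod region, col := col } :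
            LatticeSituation (thetaIndex X))
          (settingPrVolSharp X hlog M archPk archSub Ψ act Mmod region n lat sig split qData tq t htq0 htq1) ρ' qK := by
  refine exists_qPinned_and_hull_settingPrVolSharp_of_tame_slots X hlog M archPk archSub Ψ act Mmod region n lat sig split qData tq t
    htq0 htq1 col (fun pp x => norm_qIdele_le_one_of_realises X tq htq0 htq pp x)
    (fun pp => ((pp : ℕ) : ℝ) * ((pp : ℕ) : ℝ) ^ (-(1 / (m pp : ℝ)))) (fun pp => one_le_rate pp (hm1 pp))
    (fun pp i x hx => norm_eq_one_of_realises X t ht0 ht pp i x hx) (fun pp x hS => ?_) (fun pp i w hw => ?_)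
  · obtain ⟨hp2, hmx, hex⟩ := htame pp x hS
    obtain ⟨ϖ, hϖ, hle⟩ := rate_le_of_minRam X pp x (hm1 pp) hmx
    exact ⟨hp2, hex, ϖ, hϖ, hle⟩
  · obtain ⟨k, hk1, hk2, hk3⟩ := hlev pp i w hw
    exact Or.inr (slot_window_of_realises_level X tq t htq0 ht0 ht htq pp i w (hm1 pp) k hk1 hk2 hk3)

/-! ## §4. INTEGRAL pilot degrees: ONE inequality at the top label suffices -/

/-- Label monotonicity: `(j² − 1)·L ≤ j·(L² − 1)` for `1 ≤ j ≤ L` (`(L − j)(jL + 1) ≥ 0`). [folklore] -/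
theorem sq_sub_one_mul_le {j L : ℕ} (hj : 1 ≤ j) (hjL : j ≤ L) : (j ^ 2 - 1) * L ≤ j * (L ^ 2 - 1) := by
  have h1 : 1 ≤ j ^ 2 := Nat.one_le_pow _ _ hj
  have h2 : 1 ≤ L ^ 2 := Nat.one_le_pow _ _ (hj.trans hjL)
  zify [h1, h2]
  nlinarith [mul_nonneg (sub_nonneg.mpr (Nat.cast_le (α := ℤ).mpr hjL)) (by positivity : (0 : ℤ) ≤ (j : ℤ) * L + 1)]

include ht0 ht htq in
/-- **THE LICENCE FROM ONE INTEGER INEQUALITY PER BAD PLACE.** For realising ideles with INTEGRAL pilot degrees `P_q(w) = P ∈ ℤ_{≥1}` at the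
bad places (e.g. `2l ∣ ord_w(q)`, [IUTchI] Ex. 3.2 (iv)), tame fibres with `m_p ≤ e(x|p)`, and at every bad `w | p` the TOP-LABEL
shallowness **`m_p·(l⋆² − 1)·P ≤ l⋆·e_w·(m_p − 1)`**: the (xi-f) licence holds at `settingPrVolSharp`. (The level at `(w, j)` is
`k = ⌊(j²P − 1)/e_w⌋`; the top-label inequality implies the one at every label `j ≤ l⋆` by `sq_sub_one_mul_le`, and
`m_p·(e_w·k + 1) ≤ m_p·j²·P ≤ m_p·P + j·e_w·(m_p − 1)`.) [cite: DupuyHilado2025, §3.3, §3.4, §4.9] [cite: Mochizuki2012, IUTchI Ex. 3.2 (iv) p. 71]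
[claim: Mochizuki2012, status: disputed] -/
theorem licence_settingPrVolSharp_of_realises_minRam_int (m : Nat.Primes → ℕ) (hm1 : ∀ pp, 1 ≤ m pp)
    (htame : ∀ (pp : Nat.Primes) (x : (thetaIndex X).Fibre (.inr pp)),
      haveI : Fact (pp : ℕ).Prime := ⟨pp.2⟩
      (∃ w : (thetaIndex X).Fibre (.inr pp), placeOf X pp.1 w ∈ X.S) →
        2 < (pp : ℕ) ∧ m pp ≤ (placeOf X pp.1 x).asIdeal.ramificationIdx ℤ ∧
          (placeOf X pp.1 x).asIdeal.ramificationIdx ℤ ≤ (pp : ℕ) - 2)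
    (hint : ∀ (pp : Nat.Primes) (w : (thetaIndex X).Fibre (.inr pp)),
      haveI : Fact (pp : ℕ).Prime := ⟨pp.2⟩
      placeOf X pp.1 w ∈ X.S →
        ∃ P : ℕ, X.qPilot (placeOf X pp.1 w) = P ∧ 1 ≤ P ∧
          m pp * (X.lstar ^ 2 - 1) * P ≤ X.lstar * ramIdx F (placeOf X pp.1 w) * (m pp - 1)) :
    Thm311ToCor312.Licence (settingPrVolSharp X hlog M archPk archSub Ψ act Mmod region n lat sig split qData tq t htq0 htq1) := by
  refine licence_settingPrVolSharp_of_realises_minRam X hlog M archPk archSub Ψ act Mmod region n lat sig split qData tq t htq0 htq1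
    ht0 ht htq m hm1 htame (fun pp i w hw => ?_)
  haveI : Fact (pp : ℕ).Prime := ⟨pp.2⟩
  obtain ⟨P, hP, hP1, hsh⟩ := hint pp w hw
  set v := placeOf X pp.1 w with hv
  set e : ℕ := ramIdx F v with he
  set j : ℕ := (i : ℕ) + 1 with hj
  set μ : ℕ := m pp with hμ
  have he1 : 1 ≤ e := Nat.one_le_iff_ne_zero.mpr (ramIdx_ne_zero F v)
  have hj1 : 1 ≤ j := by omega
  have hjL : j ≤ X.lstar := by have := i.2; omega
  have hμ1 : 1 ≤ μ := hm1 pp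
  -- the shallowness at label `j`: `μ·(j²−1)·P ≤ j·e·(μ−1)`
  have hmono := sq_sub_one_mul_le hj1 hjL
  have hL1 : 1 ≤ X.lstar := hj1.trans hjL
  have hshj : μ * (j ^ 2 - 1) * P * X.lstar ≤ j * e * (μ - 1) * X.lstar := by
    calc μ * (j ^ 2 - 1) * P * X.lstar = μ * P * ((j ^ 2 - 1) * X.lstar) := by ring
      _ ≤ μ * P * (j * (X.lstar ^ 2 - 1)) := Nat.mul_le_mul_left _ hmono
      _ = j * (μ * (X.lstar ^ 2 - 1) * P) := by ring
      _ ≤ j * (X.lstar * e * (μ - 1)) := Nat.mul_le_mul_left _ hsh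
      _ = j * e * (μ - 1) * X.lstar := by ring
  have hshj' : μ * (j ^ 2 - 1) * P ≤ j * e * (μ - 1) := Nat.le_of_mul_le_mul_right hshj (by omega)
  -- the level `k = ⌊(j²P − 1)/e⌋`
  have hjP : 1 ≤ j ^ 2 * P := Nat.one_le_iff_ne_zero.mpr (Nat.mul_ne_zero (pow_ne_zero _ (by omega)) (by omega))
  set k : ℕ := (j ^ 2 * P - 1) / e with hk
  have hk1 : e * k + 1 ≤ j ^ 2 * P := by
    have h0 : k * e ≤ j ^ 2 * P - 1 := by rw [hk]; exact Nat.div_mul_le_self _ _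
    rw [mul_comm] at h0
    omega
  have hk2 : j ^ 2 * P ≤ e * (k + 1) := by
    have h0 : j ^ 2 * P - 1 < (j ^ 2 * P - 1) / e * e + e := Nat.lt_div_mul_add (by omega)
    rw [← hk] at h0
    have h1 : e * (k + 1) = k * e + e := by ring
    rw [h1]
    omega
  have hj2 : 1 ≤ j ^ 2 := Nat.one_le_pow _ _ hj1
  have hk3n : μ * (e * k + 1) ≤ μ * P + j * e * (μ - 1) :=
    calc μ * (e * k + 1) ≤ μ * (j ^ 2 * P) := Nat.mul_le_mul_left _ hk1
      _ = μ * (j ^ 2 - 1) * P + μ * P := by zify [hj2]; ring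
      _ ≤ j * e * (μ - 1) + μ * P := Nat.add_le_add_right hshj' _
      _ = μ * P + j * e * (μ - 1) := add_comm _ _
  have hk3r : ((μ * (e * k + 1) : ℕ) : ℝ) ≤ ((μ * P + j * e * (μ - 1) : ℕ) : ℝ) := by exact_mod_cast hk3n
  push_cast [Nat.cast_sub hμ1] at hk3r
  refine ⟨(k : ℤ), ?_, ?_, ?_⟩
  · rw [hP]; exact_mod_cast hk1
  · rw [hP]; push_cast; exact_mod_cast hk2
  · rw [hP]; push_cast; linarith [hk3r]

end Summit.ABC.IUTFork.Thm311.Real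

end
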